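import Mathlib
import Summits.PneNP.PneNP.Theorems.NegLimitedLadderAdvantage
import Literature.Computability.Complexity.GnpSprinkling
import HarnessLib

/-!
# Route NegLimited — line `sparse-ladder`, stub `stub_sparseLadderAdvantage` (rung F-N1/p3, ROUND-10)

Registered stub of the skeleton `sparse-ladder` on the rung item
`NegLimited.NeglimitedInverseLinearNegations` (stmt-PneNP-19681; HOME/pnp-ideate-p3/r10/sparse-ladder.lean,
sha dee521b8906a2977): the GENERIC telescoping step of the density ladder at an arbitrary sprinkle
density `q`.

If a MONOTONE `f` satisfies the pointwise relative bound
`Pr_A[f(x ∪ K_A) = 1] ≤ E + Pr_{y ∼ G(n,q)}[f(x ∪ y) = 1]` for every background `x`, then along the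
ladder `p_j = 1 - (1-q)^j` one has `Σ_{j ≤ T} plantFlipProb(p_j, f) ≤ (T+1) E + 1`:
average the hypothesis over `x ∼ G(n, p_j)` (weights `gnpWeight ≥ 0`, total mass `1`), rewrite the
sprinkled side with the union law `G(n,p_j) ∪ G(n,q) = G(n, p_j ⊕ q)` (`sum_sum_gnpWeight_ite_sup`) and
the ladder identity `p_j ⊕ q = p_{j+1}`, rewrite the planted side with
`NegLimitedLadder.plantFlipProb_eq_of_monotone` (monotone flips are differences of acceptance
probabilities), and telescope (`0 ≤ φ ≤ 1`).  Literally the proof of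
`NegLimitedLadder.stub_ladderAdvantage` (line `density-ladder`, Theorems/NegLimitedLadderAdvantage.lean)
with the pointwise hypothesis in place of `rsd_at_admissible_dose`.

References: B. Rossman, *The monotone complexity of k-clique on random graphs*, FOCS 2010 /
SIAM J. Comput. 43 (2014), Thm 1 (p. 4), §7 (p. 10) [Rossman2010]; cell record
HOME/pnp-ideate-p3/r10/sparse-ladder.md §Stubs 1.
-/

set_option linter.dupNamespace false -- `Summit.PneNP.PneNP.…`: summit = sub-problem name (D-0017 single-conjunct layout)

noncomputable section

namespace Summit.PneNP.PneNP.Theorems.NegLimitedSparseLadder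

open Finset Filter
open Literature.Computability.Complexity
open Summit.PneNP.PneNP.Theorems.NegLimitedLadder

/-! ### The stub statement (verbatim from the registered skeleton `sparse-ladder`) -/

/-- stub target `SparseLadderAdvantage` (verbatim from HOME/pnp-ideate-p3/r10/sparse-ladder.lean; generic
telescoping at sprinkle density `q`): if a MONOTONE `f` satisfies the pointwise relative bound
`Pr_A[f(x ∪ K_A)] ≤ E + Pr_{y ∼ G(n,q)}[f(x ∪ y)]` for every background `x`, then along the ladder
`p_j = 1 - (1-q)^j`, `Σ_{j ≤ T} plantFlipProb(p_j, f) ≤ (T+1) E + 1`. -/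
def SparseLadderAdvantage : Prop :=
  ∀ (n k : ℕ), k ≤ n → ∀ (q E : ℝ), 0 ≤ q → q ≤ 1 →
    ∀ f : (↥(⊤ : SimpleGraph (Fin n)).edgeSet → Bool) → Bool, Monotone f →
      (∀ x : ↥(⊤ : SimpleGraph (Fin n)).edgeSet → Bool,
        kSubsetProb n k (fun A => f (x ⊔ cliqueVec A) = true) ≤
          E + gnpProb n q (univ.filter fun y => f (x ⊔ y) = true)) →
      ∀ T : ℕ, ∑ j ∈ range (T + 1), plantFlipProb n k (1 - (1 - q) ^ j) f ≤ ((T : ℝ) + 1) * E + 1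

/-! ### One rung at an arbitrary background density -/

/-- **The averaged rung.** For a monotone `f` with the pointwise relative bound at sprinkle density
`0 ≤ q ≤ 1`, and any background density `0 ≤ p ≤ 1`:
`plantFlipProb n k p f ≤ E + Pr[f(G(n, p ⊕ q)) = 1] - Pr[f(G(n,p)) = 1]`, `p ⊕ q = p + q - p q`
(average over `x ∼ G(n,p)`, union law `sum_sum_gnpWeight_ite_sup`, `plantFlipProb_eq_of_monotone`). -/
theorem plantFlipProb_le_of_pointwise {n k : ℕ} (hkn : k ≤ n) {q E p : ℝ} (hp0 : 0 ≤ p) (hp1 : p ≤ 1)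
    {f : (↥(⊤ : SimpleGraph (Fin n)).edgeSet → Bool) → Bool} (hf : Monotone f)
    (hpt : ∀ x : ↥(⊤ : SimpleGraph (Fin n)).edgeSet → Bool,
      kSubsetProb n k (fun A => f (x ⊔ cliqueVec A) = true) ≤
        E + gnpProb n q (univ.filter fun y => f (x ⊔ y) = true)) :
    plantFlipProb n k p f ≤
      E + (gnpProb n (p + q - p * q) (univ.filter fun x => f x = true) -
        gnpProb n p (univ.filter fun x => f x = true)) := by
  classical
  -- the inner sum is `w_p(x) · Pr_{y ∼ G(n,q)}[f(x ∨ y) = 1]`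
  have hinner : ∀ x : (⊤ : SimpleGraph (Fin n)).edgeSet → Bool,
      ∑ y : (⊤ : SimpleGraph (Fin n)).edgeSet → Bool,
          gnpWeight n p x * gnpWeight n q y * (if f (x ⊔ y) = true then (1 : ℝ) else 0) =
        gnpWeight n p x * gnpProb n q (univ.filter fun y => f (x ⊔ y) = true) := by
    intro x
    rw [gnpProb_filter, mul_sum]
    refine sum_congr rfl fun y _ => ?_
    split_ifs <;> ring
  -- total mass one
  have hmass : ∑ x : (⊤ : SimpleGraph (Fin n)).edgeSet → Bool, gnpWeight n p x = 1 := by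
    have := gnpProb_univ n p
    rwa [gnpProb] at this
  -- the averaged hypothesis
  have havg : ∑ x : (⊤ : SimpleGraph (Fin n)).edgeSet → Bool, gnpWeight n p x *
        kSubsetProb n k (fun A => f (x ⊔ cliqueVec A) = true) ≤
      E + ∑ x : (⊤ : SimpleGraph (Fin n)).edgeSet → Bool,
        ∑ y : (⊤ : SimpleGraph (Fin n)).edgeSet → Bool,
          gnpWeight n p x * gnpWeight n q y * (if f (x ⊔ y) = true then (1 : ℝ) else 0) := by
    calc ∑ x : (⊤ : SimpleGraph (Fin n)).edgeSet → Bool, gnpWeight n p x *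
          kSubsetProb n k (fun A => f (x ⊔ cliqueVec A) = true)
        ≤ ∑ x : (⊤ : SimpleGraph (Fin n)).edgeSet → Bool, gnpWeight n p x *
            (E + gnpProb n q (univ.filter fun y => f (x ⊔ y) = true)) :=
          sum_le_sum fun x _ => mul_le_mul_of_nonneg_left (hpt x) (gnpWeight_nonneg hp0 hp1 x)
      _ = E + ∑ x : (⊤ : SimpleGraph (Fin n)).edgeSet → Bool, gnpWeight n p x *
            gnpProb n q (univ.filter fun y => f (x ⊔ y) = true) := by
          simp_rw [mul_add]
          rw [sum_add_distrib, ← sum_mul, hmass, one_mul]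
      _ = _ := by
          congr 1
          exact sum_congr rfl fun x _ => (hinner x).symm
  rw [sum_sum_gnpWeight_ite_sup p q (fun z => f z = true)] at havg
  rw [plantFlipProb_eq_of_monotone hkn p hf]
  linarith

/-! ### The stub -/

/-- **Stub `stub_sparseLadderAdvantage` of line `sparse-ladder` PROVED** (`SparseLadderAdvantage`, by
name): sum the rungs `plantFlipProb(p_j) ≤ E + φ(p_{j+1}) - φ(p_j)` (`plantFlipProb_le_of_pointwise` with
the ladder identity `p_j ⊕ q = p_{j+1}`) over `j ≤ T` and telescope (`φ ∈ [0,1]`). -/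
theorem stub_sparseLadderAdvantage : SparseLadderAdvantage := by
  intro n k hkn q E hq0 hq1 f hf hpt T
  classical
  set φ : ℕ → ℝ := fun j => gnpProb n (1 - (1 - q) ^ j) (univ.filter fun x => f x = true)
    with hφ
  have h1q0 : 0 ≤ 1 - q := by linarith
  have h1q1 : 1 - q ≤ 1 := by linarith
  have hP0 : ∀ j : ℕ, 0 ≤ 1 - (1 - q) ^ j := fun j => by
    have := pow_le_one₀ h1q0 h1q1 (n := j); linarith
  have hP1 : ∀ j : ℕ, 1 - (1 - q) ^ j ≤ 1 := fun j => by
    have := pow_nonneg h1q0 j; linarith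
  -- one rung, with the ladder identity `p_j ⊕ q = p_{j+1}`
  have hrung : ∀ j : ℕ, plantFlipProb n k (1 - (1 - q) ^ j) f ≤ E + (φ (j + 1) - φ j) := by
    intro j
    have h := plantFlipProb_le_of_pointwise hkn (hP0 j) (hP1 j) hf hpt
    have hlad : 1 - (1 - q) ^ j + q - (1 - (1 - q) ^ j) * q = 1 - (1 - q) ^ (j + 1) := by ring
    rw [hlad] at h
    exact h
  -- sum and telescope
  have hφ0 : 0 ≤ φ 0 := gnpProb_nonneg (hP0 0) (hP1 0) _
  have hφT : φ (T + 1) ≤ 1 := gnpProb_le_one (hP0 (T + 1)) (hP1 (T + 1)) _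
  calc ∑ j ∈ range (T + 1), plantFlipProb n k (1 - (1 - q) ^ j) f
      ≤ ∑ j ∈ range (T + 1), (E + (φ (j + 1) - φ j)) := sum_le_sum fun j _ => hrung j
    _ = ((T : ℝ) + 1) * E + (φ (T + 1) - φ 0) := by
        rw [sum_add_distrib, sum_const, card_range, nsmul_eq_mul, sum_range_sub]
        push_cast
        ring
    _ ≤ ((T : ℝ) + 1) * E + 1 := by linarith

end Summit.PneNP.PneNP.Theorems.NegLimitedSparseLadder
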